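import Mathlib
import HarnessLib
import Summits.HubbardSuperconductivity.HubbardSuperconductivity.Theorems.KLProgrammeKLRegimeSplitEdgeFactsBandJets
import Summits.HubbardSuperconductivity.HubbardSuperconductivity.Theorems.KLProgrammeH10TwoPointLimitFramePerturbation
import Summits.HubbardSuperconductivity.HubbardSuperconductivity.Theorems.KLProgrammeKLRegimeCountertermPieceLipschitz

/-!
# Route `KLProgramme` — edge facts for the pair masses ACROSS TRANSFERS, V′: the BAND LATTICE JETS keyed to the frame's `C²` SIZE
# `‖Dʲ(frameShift K)‖ ≤ A` (`j ≤ 2`) — `|δ^±_Q e_K| ≤ (4 + 2A)·|p_Q|_𝕋`, `|δ²_Q e_K| ≤ (4 + 8A)·|p_Q|_𝕋²` — the regime-native keying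

Cell gate-hubbard-kl, seat hubbard-kl-k3c1-p1 (g22; child-1 lineage); cure of the located «(s2)-JETS-COEFFNORM-KEYING» (HOME/STATUS 2026-08-29 ≈13:45Z).
WHY.  Row 20 (`…SplitEdgeFactsBandJets`, g21) keys the jets of the frame band `e_K = ε_L − μ − K` to the COEFFICIENT WEIGHTS `coeffNorm 1 K`, `coeffNorm 2 K`
(and its numeric corollary to `IsAdmissibleFrame K` = `coeffNorm 2 K ≤ 16`).  The consumers of rows 20–34 are the named pair masses at the FLOW frames
`K_n = klFlowFrameU … n`, whose coefficient weights are not n-flat: `coeffNorm r K_n ≤ Σ_{m<n} 4(2d_m+1)(1+4d_m)^r·cr|U|Λ_m²/e₀` with `d_m = 2⁷4^m`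
(`…VolumeLimitFlowFramesCoeffNorm`, k3c5-p3) is `≈ 2¹⁴·n·cr|U|` at `r = 1` and `≈ 2²¹·4ⁿ·cr|U|` at `r = 2`.  The regime-native size of a frame is its `C²` size on
`Momentum`: `‖Dʲ(frameShift K)(p)‖ ≤ A` for `j ≤ 2` — for EVERY `FrameOK R U (nScales β) μ K` in the KL regime `A = 2Gfr₀|U| + 2Gfr₁U² + Gfr₂·c/log 4` works
(`PerturbedFermiCurve.norm_iteratedFDeriv_frameShift_le_of_frameOK_regime`, n-flat and β-uniform), and it is the datum the class-#5 adapters and the (c) doors already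
carry (`hAb`).  THIS FILE re-keys the three atoms to it:
* §1 frames on `Fin 2 → ℝ`: `|K(p + x) − K(p)| ≤ 2A·max(|x₀|_𝕋, |x₁|_𝕋)` (periodic representative of `x` in `(−π, π]²`, then the `ℓ¹` mean-value bound
  `abs_eval_sub_eval_le_of_norm_iteratedFDeriv_one_le`), and `|K(p + x) − 2K(p) + K(p − x)| ≤ 8A·max(|x₀|_𝕋, |x₁|_𝕋)²` (mean value theorem on
  `t ↦ δ_K(p + t·r) + δ_K(p − t·r)`, whose derivative is `(Dδ_K(p + tr) − Dδ_K(p − tr))·r`, with `Dδ_K` `4A`-Lipschitz on the sup-normed `ℝ²`);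
* §2 the torus: **`klbs_abs_nambuXiCT_add_sub_le` / `_sub_sub_le`** (`|e_K(k±Q) − e_K(k)| ≤ (4 + 2A)·|p_Q|_𝕋`), **`klbs_abs_nambuXiCT_secondDiff_le`**
  (`|e_K(k+Q) − 2e_K(k) + e_K(k−Q)| ≤ (4 + 8A)·|p_Q|_𝕋²`), the bundled form `klbs_nambuXiCT_jets` and the REGIME form **`klbs_nambuXiCT_jets_of_frameOK_regime`**
  (`FrameOK R U (nScales β) μ K`, `klBetaMin ≤ β ≤ e^{c/U²}` ⇒ the three jets with `A = 2Gfr₀|U| + 2Gfr₁U² + Gfr₂·c/log 4`).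
The abstract twins of rows 21–34 (jet constants `(v, κ)` as hypotheses) consume either keying.  Everything is proved; no definitions; nothing asserts any slot, stub, K3 or SC.
References: BGM 2006 §2.4 (the frame/dispersion perturbation sizes along the flow, (2.36)) [cite: BenfattoGiulianiMastropietro2006]; the jets themselves [folklore].
-/

noncomputable section

namespace Summit.HubbardSuperconductivity.HubbardSuperconductivity.Theorems.KLRegimeSplit

set_option linter.dupNamespace false -- summit = problem name (single-conjunct summit), D-0017

open Real Finset Literature.MathematicalPhysics.QuantumLattice Literature.Probability.LatticeModels
open Summit.HubbardSuperconductivity.HubbardSuperconductivity.Theorems.KLProgrammeLegKernels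
open Summit.HubbardSuperconductivity.HubbardSuperconductivity.Theorems.DispersionFlow
open Summit.HubbardSuperconductivity.HubbardSuperconductivity.Theorems.PerturbedFermiCurve

/-! ## §1 Frames on `Fin 2 → ℝ`: first and second differences against the `C²` size of `frameShift K` -/

section Frame

variable {K : TrigPolyC4v} {A : ℝ} (hA : ∀ p : Momentum, ∀ j ≤ 2, ‖iteratedFDeriv ℝ j (frameShift K) p‖ ≤ A)
include hA

/-- The order-one size of `evalM K` on `Momentum`: `‖D¹(evalM K)(q)‖ ≤ A` (`frameShift K = −evalM K`). -/
theorem klbs_norm_iteratedFDeriv_one_evalM_le (q : Momentum) : ‖iteratedFDeriv ℝ 1 (evalM K) q‖ ≤ A := by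
  have h := hA q 1 (by norm_num)
  have e : frameShift K = -evalM K := by funext p; rfl
  rw [e, iteratedFDeriv_neg_apply, norm_neg] at h
  exact h

/-- **First difference of a frame, `ℓ¹` form**: `|K(p) − K(p′)| ≤ A·(|p₀ − p′₀| + |p₁ − p′₁|)`. [folklore] -/
theorem klbs_abs_eval_sub_le (p p' : Fin 2 → ℝ) : |K.eval p - K.eval p'| ≤ A * (|p 0 - p' 0| + |p 1 - p' 1|) :=
  abs_eval_sub_eval_le_of_norm_iteratedFDeriv_one_le K (klbs_norm_iteratedFDeriv_one_evalM_le hA) p p'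

/-- **First difference of a frame at a step `x`, modulo `2πℤ²`**: `|K(p + x) − K(p)| ≤ 2A·max(|x₀|_𝕋, |x₁|_𝕋)` (periodicity puts `x` in `(−π, π]²`). [folklore] -/
theorem klbs_abs_eval_add_sub_le (p x : Fin 2 → ℝ) : |K.eval (p + x) - K.eval p| ≤ 2 * A * torusSupNorm (x 0, x 1) := by
  obtain ⟨r₀, z₀, hx₀, hr₀⟩ := klbj_exists_rep (x 0)
  obtain ⟨r₁, z₁, hx₁, hr₁⟩ := klbj_exists_rep (x 1)
  set r : Fin 2 → ℝ := ![r₀, r₁] with hr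
  set z : Fin 2 → ℤ := ![z₀, z₁] with hz
  have hper : K.eval (p + x) = K.eval (p + r) := by
    have e : p + x = fun i => (p + r) i + z i * (2 * π) := by
      funext i; fin_cases i <;> simp [hr, hz, hx₀, hx₁] <;> ring
    rw [e, TrigPolyC4v.eval_periodic]
  rw [hper]
  have h := klbs_abs_eval_sub_le hA (p + r) p
  simp only [Pi.add_apply, add_sub_cancel_left] at h
  obtain ⟨h0, h1⟩ := klbj_torusAbs_le_torusSupNorm x
  rw [hr₀] at h0; rw [hr₁] at h1
  have e0 : r 0 = r₀ := by simp [hr]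
  have e1 : r 1 = r₁ := by simp [hr]
  rw [e0, e1] at h
  have hA0 : 0 ≤ A := (norm_nonneg _).trans (hA 0 0 (by norm_num))
  calc |K.eval (p + r) - K.eval p| ≤ A * (|r₀| + |r₁|) := h
    _ ≤ A * (2 * torusSupNorm (x 0, x 1)) := mul_le_mul_of_nonneg_left (by linarith) hA0
    _ = 2 * A * torusSupNorm (x 0, x 1) := by ring

/-- `Dδ_K` is `4A`-Lipschitz on the sup-normed `ℝ²` (`‖D²δ_K‖ ≤ 4A`, `norm_fderiv_fderiv_frameShift_toLp_le`, mean value theorem). -/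
theorem klbs_norm_fderiv_sub_le (x y : Fin 2 → ℝ) :
    ‖fderiv ℝ (fun k : Fin 2 → ℝ => -K.eval k) x - fderiv ℝ (fun k : Fin 2 → ℝ => -K.eval k) y‖ ≤ 4 * A * ‖x - y‖ := by
  have hC2 : ContDiff ℝ 2 (fun k : Fin 2 → ℝ => -K.eval k) := by
    rw [← frameShift_toLp_eq_neg_eval]; exact contDiff_frameShift_toLp K
  have hdiff : Differentiable ℝ (fderiv ℝ (fun k : Fin 2 → ℝ => -K.eval k)) :=
    (hC2.fderiv_right (m := 1) (by norm_num)).differentiable (by norm_num)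
  have hbound : ∀ z ∈ (Set.univ : Set (Fin 2 → ℝ)), ‖fderiv ℝ (fderiv ℝ (fun k : Fin 2 → ℝ => -K.eval k)) z‖ ≤ 4 * A := fun z _ => by
    rw [← frameShift_toLp_eq_neg_eval]; exact norm_fderiv_fderiv_frameShift_toLp_le hA z
  exact (convex_univ (𝕜 := ℝ) (E := Fin 2 → ℝ)).norm_image_sub_le_of_norm_fderiv_le (fun z _ => hdiff z) hbound (Set.mem_univ y) (Set.mem_univ x)

/-- **Second difference of a frame along a vector**: `|K(p + r) − 2K(p) + K(p − r)| ≤ 8A·‖r‖²` (`‖·‖` the sup norm of `ℝ²`): the mean value theorem on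
`φ(t) = δ_K(p + t·r) + δ_K(p − t·r)`, `φ′(t) = (Dδ_K(p + tr) − Dδ_K(p − tr))·r`, `|φ′(t)| ≤ 4A·‖2tr‖·‖r‖ ≤ 8A‖r‖²` on `(0, 1)`. [folklore] -/
theorem klbs_abs_eval_secondDiff_vec_le (p r : Fin 2 → ℝ) : |K.eval (p + r) - 2 * K.eval p + K.eval (p - r)| ≤ 8 * A * ‖r‖ ^ 2 := by
  set δ : (Fin 2 → ℝ) → ℝ := fun k => -K.eval k with hδ
  have hC2 : ContDiff ℝ 2 δ := by
    rw [hδ, ← frameShift_toLp_eq_neg_eval]; exact contDiff_frameShift_toLp K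
  have hdiff : Differentiable ℝ δ := hC2.differentiable (by norm_num)
  -- the path and its derivative
  set φ : ℝ → ℝ := fun t => δ (p + t • r) + δ (p - t • r) with hφ
  have hline₁ : ∀ t : ℝ, HasDerivAt (fun t : ℝ => p + t • r) r t := fun t => by
    have h := ((hasDerivAt_id t).smul_const r).const_add p
    simpa using h
  have hline₂ : ∀ t : ℝ, HasDerivAt (fun t : ℝ => p - t • r) (-r) t := fun t => by
    have h := ((hasDerivAt_id t).smul_const r).const_sub p
    simpa using h
  have hderiv : ∀ t : ℝ, HasDerivAt φ (fderiv ℝ δ (p + t • r) r + fderiv ℝ δ (p - t • r) (-r)) t := fun t => by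
    have h1 := (hdiff (p + t • r)).hasFDerivAt.comp_hasDerivAt t (hline₁ t)
    have h2 := (hdiff (p - t • r)).hasFDerivAt.comp_hasDerivAt t (hline₂ t)
    exact h1.add h2
  have hcont : ContinuousOn φ (Set.Icc 0 1) := fun t _ => (hderiv t).continuousAt.continuousWithinAt
  have hdiffφ : DifferentiableOn ℝ φ (Set.Ioo 0 1) := fun t _ => (hderiv t).differentiableAt.differentiableWithinAt
  obtain ⟨ξ, hξ, hslope⟩ := exists_deriv_eq_slope φ (by norm_num : (0 : ℝ) < 1) hcont hdiffφ
  have hξd : deriv φ ξ = fderiv ℝ δ (p + ξ • r) r + fderiv ℝ δ (p - ξ • r) (-r) := (hderiv ξ).deriv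
  have hφ1 : φ 1 = δ (p + r) + δ (p - r) := by simp [hφ]
  have hφ0 : φ 0 = 2 * δ p := by simp [hφ]; ring
  have hval : K.eval (p + r) - 2 * K.eval p + K.eval (p - r) = -(φ 1 - φ 0) := by
    rw [hφ1, hφ0]; simp [hδ]; ring
  have hslope' : φ 1 - φ 0 = deriv φ ξ := by rw [hslope]; norm_num
  -- size of the derivative at ξ
  have hlin : fderiv ℝ δ (p + ξ • r) r + fderiv ℝ δ (p - ξ • r) (-r) = (fderiv ℝ δ (p + ξ • r) - fderiv ℝ δ (p - ξ • r)) r := by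
    rw [FunLike.coe_sub, Pi.sub_apply, map_neg]; ring
  have hLip := klbs_norm_fderiv_sub_le hA (p + ξ • r) (p - ξ • r)
  have hdist : ‖(p + ξ • r) - (p - ξ • r)‖ = 2 * ξ * ‖r‖ := by
    have e : (p + ξ • r) - (p - ξ • r) = (2 * ξ) • r := by rw [add_sub_sub_cancel, ← add_smul]; ring_nf
    rw [e, norm_smul, Real.norm_eq_abs, abs_of_pos (by linarith [hξ.1])]
  have hA0 : 0 ≤ A := (norm_nonneg _).trans (hA 0 0 (by norm_num))
  have hξ1 : ξ ≤ 1 := hξ.2.le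
  rw [hval, abs_neg, hslope', hξd, hlin]
  calc |(fderiv ℝ δ (p + ξ • r) - fderiv ℝ δ (p - ξ • r)) r|
      ≤ ‖fderiv ℝ δ (p + ξ • r) - fderiv ℝ δ (p - ξ • r)‖ * ‖r‖ := by
        rw [← Real.norm_eq_abs]; exact ContinuousLinearMap.le_opNorm _ _
    _ ≤ 4 * A * ‖(p + ξ • r) - (p - ξ • r)‖ * ‖r‖ := mul_le_mul_of_nonneg_right hLip (norm_nonneg _)
    _ = 8 * A * ξ * ‖r‖ ^ 2 := by rw [hdist]; ring
    _ ≤ 8 * A * 1 * ‖r‖ ^ 2 := by gcongr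
    _ = 8 * A * ‖r‖ ^ 2 := by ring

/-- **Second difference of a frame at a step `x`, modulo `2πℤ²`**: `|K(p + x) − 2K(p) + K(p − x)| ≤ 8A·max(|x₀|_𝕋, |x₁|_𝕋)²`. [folklore] -/
theorem klbs_abs_eval_secondDiff_le (p x : Fin 2 → ℝ) :
    |K.eval (p + x) - 2 * K.eval p + K.eval (p - x)| ≤ 8 * A * torusSupNorm (x 0, x 1) ^ 2 := by
  obtain ⟨r₀, z₀, hx₀, hr₀⟩ := klbj_exists_rep (x 0)
  obtain ⟨r₁, z₁, hx₁, hr₁⟩ := klbj_exists_rep (x 1)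
  set r : Fin 2 → ℝ := ![r₀, r₁] with hr
  set z : Fin 2 → ℤ := ![z₀, z₁] with hz
  have hperp : K.eval (p + x) = K.eval (p + r) := by
    have e : p + x = fun i => (p + r) i + z i * (2 * π) := by
      funext i; fin_cases i <;> simp [hr, hz, hx₀, hx₁] <;> ring
    rw [e, TrigPolyC4v.eval_periodic]
  have hperm : K.eval (p - x) = K.eval (p - r) := by
    have e : p - x = fun i => (p - r) i + (-z) i * (2 * π) := by
      funext i; fin_cases i <;> simp [hr, hz, hx₀, hx₁] <;> ring
    rw [e, TrigPolyC4v.eval_periodic]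
  rw [hperp, hperm]
  have h := klbs_abs_eval_secondDiff_vec_le hA p r
  have hnorm : ‖r‖ ≤ torusSupNorm (x 0, x 1) := by
    refine (pi_norm_le_iff_of_nonneg (torusSupNorm_nonneg _)).2 fun i => ?_
    obtain ⟨h0, h1⟩ := klbj_torusAbs_le_torusSupNorm x
    fin_cases i
    · simpa [hr, Real.norm_eq_abs, ← hr₀] using h0
    · simpa [hr, Real.norm_eq_abs, ← hr₁] using h1
  have hA0 : 0 ≤ A := (norm_nonneg _).trans (hA 0 0 (by norm_num))
  exact h.trans (mul_le_mul_of_nonneg_left (pow_le_pow_left₀ (norm_nonneg _) hnorm 2) (by positivity))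

end Frame

/-! ## §2 The torus `(ℤ/Lℤ)²`: the three band lattice jets keyed to the `C²` size, and the regime form -/

section Torus

variable {L : ℕ} [NeZero L] (μ : ℝ) {K : TrigPolyC4v} {A : ℝ} (hA : ∀ p : Momentum, ∀ j ≤ 2, ‖iteratedFDeriv ℝ j (frameShift K) p‖ ≤ A)
include hA

/-- **BAND LATTICE JET, first order (forward), `C²`-keyed**: `|e_K(k+Q) − e_K(k)| ≤ (4 + 2A)·|p_Q|_𝕋`. [folklore] -/
theorem klbs_abs_nambuXiCT_add_sub_le (k Q : TorusSite 2 L) :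
    |nambuXiCT L μ K (k + Q) - nambuXiCT L μ K k| ≤ (4 + 2 * A) * klTorusNorm L Q := by
  have hK : |K.eval (latticeMomentum L (k + Q)) - K.eval (latticeMomentum L k)| ≤ 2 * A * klTorusNorm L Q := by
    rw [klbj_eval_latticeMomentum_add]; exact klbs_abs_eval_add_sub_le hA (latticeMomentum L k) (latticeMomentum L Q)
  have hb := klbj_abs_torusBand_add_sub_le k Q
  rw [show nambuXiCT L μ K (k + Q) - nambuXiCT L μ K k =
      (torusBand L (k + Q) - torusBand L k) - (K.eval (latticeMomentum L (k + Q)) - K.eval (latticeMomentum L k)) by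
    simp only [nambuXiCT]; ring]
  exact (abs_sub _ _).trans (by linarith)

/-- **BAND LATTICE JET, first order (backward), `C²`-keyed**: `|e_K(k−Q) − e_K(k)| ≤ (4 + 2A)·|p_Q|_𝕋`. [folklore] -/
theorem klbs_abs_nambuXiCT_sub_sub_le (k Q : TorusSite 2 L) :
    |nambuXiCT L μ K (k - Q) - nambuXiCT L μ K k| ≤ (4 + 2 * A) * klTorusNorm L Q := by
  have h := klbs_abs_nambuXiCT_add_sub_le μ hA (k - Q) Q
  rwa [sub_add_cancel, abs_sub_comm] at h

/-- **BAND LATTICE JET, second order, `C²`-keyed**: `|e_K(k+Q) − 2e_K(k) + e_K(k−Q)| ≤ (4 + 8A)·|p_Q|_𝕋²`. [folklore] -/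
theorem klbs_abs_nambuXiCT_secondDiff_le (k Q : TorusSite 2 L) :
    |nambuXiCT L μ K (k + Q) - 2 * nambuXiCT L μ K k + nambuXiCT L μ K (k - Q)| ≤ (4 + 8 * A) * klTorusNorm L Q ^ 2 := by
  have hK : |K.eval (latticeMomentum L (k + Q)) - 2 * K.eval (latticeMomentum L k) + K.eval (latticeMomentum L (k - Q))| ≤
      8 * A * klTorusNorm L Q ^ 2 := by
    rw [klbj_eval_latticeMomentum_add, klbj_eval_latticeMomentum_sub]
    exact klbs_abs_eval_secondDiff_le hA (latticeMomentum L k) (latticeMomentum L Q)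
  have hb := klbj_abs_torusBand_secondDiff_le k Q
  rw [show nambuXiCT L μ K (k + Q) - 2 * nambuXiCT L μ K k + nambuXiCT L μ K (k - Q) =
      (torusBand L (k + Q) - 2 * torusBand L k + torusBand L (k - Q)) -
        (K.eval (latticeMomentum L (k + Q)) - 2 * K.eval (latticeMomentum L k) + K.eval (latticeMomentum L (k - Q))) by
    simp only [nambuXiCT]; ring]
  exact (abs_sub _ _).trans (by linarith)

/-- **The three jets bundled** (the shape the abstract twins of rows 21–34 take as hypotheses, with `v = 4 + 2A`, `κ = 4 + 8A`). [folklore] -/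
theorem klbs_nambuXiCT_jets :
    (∀ k Q : TorusSite 2 L, |nambuXiCT L μ K (k + Q) - nambuXiCT L μ K k| ≤ (4 + 2 * A) * klTorusNorm L Q) ∧
      (∀ k Q : TorusSite 2 L, |nambuXiCT L μ K (k - Q) - nambuXiCT L μ K k| ≤ (4 + 2 * A) * klTorusNorm L Q) ∧
        ∀ k Q : TorusSite 2 L, |nambuXiCT L μ K (k + Q) - 2 * nambuXiCT L μ K k + nambuXiCT L μ K (k - Q)| ≤ (4 + 8 * A) * klTorusNorm L Q ^ 2 :=
  ⟨fun k Q => klbs_abs_nambuXiCT_add_sub_le μ hA k Q, fun k Q => klbs_abs_nambuXiCT_sub_sub_le μ hA k Q,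
    fun k Q => klbs_abs_nambuXiCT_secondDiff_le μ hA k Q⟩

omit hA in
/-- **THE REGIME FORM**: for an admissible frame of the KL regime — `FrameOK R U (nScales β) μ′ K`, `klBetaMin ≤ β ≤ e^{c/U²}`, `0 ≤ c`, `0 ≤ Gfr j` — the three
jets hold with the n-flat, β-uniform size `A = 2·Gfr 0·|U| + 2·Gfr 1·U² + Gfr 2·(c/log 4)` (`norm_iteratedFDeriv_frameShift_le_of_frameOK_regime`):
`v = 4 + 2A`, `κ = 4 + 8A`.  (The frame's own `μ′`, `U`, `N` enter only through `A`.) [cite: BenfattoGiulianiMastropietro2006, §2.4 (2.36)] -/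
theorem klbs_nambuXiCT_jets_of_frameOK_regime {R : RenConsts} (hR : ∀ j, 0 ≤ R.Gfr j) {U c β μ' : ℝ}
    (hc : 0 ≤ c) (hβmin : klBetaMin ≤ β) (hβc : β ≤ Real.exp (c / U ^ 2)) (hK : FrameOK R U (nScales β) μ' K) :
    (∀ k Q : TorusSite 2 L, |nambuXiCT L μ K (k + Q) - nambuXiCT L μ K k| ≤
        (4 + 2 * (2 * R.Gfr 0 * |U| + 2 * R.Gfr 1 * U ^ 2 + R.Gfr 2 * (c / Real.log 4))) * klTorusNorm L Q) ∧
      (∀ k Q : TorusSite 2 L, |nambuXiCT L μ K (k - Q) - nambuXiCT L μ K k| ≤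
        (4 + 2 * (2 * R.Gfr 0 * |U| + 2 * R.Gfr 1 * U ^ 2 + R.Gfr 2 * (c / Real.log 4))) * klTorusNorm L Q) ∧
        ∀ k Q : TorusSite 2 L, |nambuXiCT L μ K (k + Q) - 2 * nambuXiCT L μ K k + nambuXiCT L μ K (k - Q)| ≤
          (4 + 8 * (2 * R.Gfr 0 * |U| + 2 * R.Gfr 1 * U ^ 2 + R.Gfr 2 * (c / Real.log 4))) * klTorusNorm L Q ^ 2 :=
  klbs_nambuXiCT_jets μ fun p _ hj => norm_iteratedFDeriv_frameShift_le_of_frameOK_regime hR hc hβmin hβc hK p hj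

end Torus

end Summit.HubbardSuperconductivity.HubbardSuperconductivity.Theorems.KLRegimeSplit

end
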